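import Summits.Parity.GeneralizedHardyLittlewood.Theorems.PrimeLevelFamEdgeMomentsBeyondDiagonalLayersBandFromLayerBound
import Summits.Parity.GeneralizedHardyLittlewood.Theorems.PrimeLevelFamEdgeMomentsBeyondDiagonalLayersHeckeReindex
import HarnessLib

/-!
# Route `PrimeLevelFamEdge`, crux K_A `MomentsBeyondDiagonal` (stmt-Parity-20007), line «petersson_layers» v4:
# a PETERSSON LAYER from its ORDER-`(i, j)` DIVISOR-FIRST SUMS — second layer of the `stub_farP` assembly

After `…LayersBandFromLayerBound` (`SubFar rhoP` ⟸ a per-layer power saving `‖K_r‖ ≤ C q̂^{1−δ}/r` in the print band) this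
file removes the polynomial `Q` from the remaining obligation.  By `layer_eq_sum_divisors_first` (p819872/p820247) every layer is
`K_r = Σ_{i,j ≤ deg Q} QᵢQⱼ ℓ^{−(i+j)} (1+(−1)^{i+j}) q̂ · I_{ij}(r)` with the `Q`-FREE order-`(i,j)` divisor-first sum
`I_{ij}(r) = Σ_{d₁,d₂ ≤ M} Σ_{m₁' ≤ M/d₁, n₁' ≤ q²/d₁, m₂' ≤ M/d₂, n₂' ≤ q²/d₂} [(d₁n₁'d₂n₂')^{−1/2} W_{ij}(q̂; d₁n₁', d₂n₂')] ·
[x_{d₁m₁'} x_{d₂m₂'} · K_r-kernel(m₁'n₁', m₂'n₂')]`: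
* `norm_layer_le_of_order_le`: `‖K_r‖ ≤ 2 q̂ Σ_{i,j ≤ deg Q} |Qᵢ||Qⱼ| G_{ij}` from `‖I_{ij}(r)‖ ≤ G_{ij}` (`q ≥ 324`, so `ℓ ≥ 1`);
* **`subFar_rhoP_of_order_bound`** / `subBand_rhoP_rhoWeil_of_order_bound`: `SubFar rhoP` (resp. the print band) ⟸ for every
  admissible `P` and `Δ'` in a window `(1, Δ₀]` ONE saving exponent `δ > 0` and, for every order `(i, j)`, constants `A, q₀` with
  `‖I_{ij}(r)‖ ≤ A q̂^{−δ}/r` on the band `⌊q̂^{ρ_P}⌋ < r ≤ ⌊q̂^{ρ_W}⌋` for primes `q ≥ q₀`.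
So the stub's remaining content is a statement about the EXPLICIT sums `I_{ij}(r)` (AFE weight × Möbius coefficients ×
Kloosterman–Bessel kernel), uniformly over a short window; per the census (CENSUS-leafhand2-g0-stub_farP-band{,-v2}.md) it is
funded by Pascadi Thm 7.1 after the balanced regrouping (conditional bricks `…LayersBlockPascadiBound`, `…LayersPascadiBridge`).
Proof only (def-free helper); no layer is bounded here; K_A NOT proved; nothing about Landau–Siegel zeros.
-/

noncomputable section

open Finset Polynomial
open Literature.NumberTheory.LFunctions

namespace Summit.Parity.GeneralizedHardyLittlewood.Theorems.MomentsBeyondDiagonal.Layers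

open Summit.Parity.GeneralizedHardyLittlewood.Theorems.PrimeLevelFamEdgeIdeaDeltas.PeterssonLayers
open Summit.Parity.GeneralizedHardyLittlewood.Theorems.MomentsBeyondDiagonal.FarLayers (subFar_rhoP_of_band)
open Summit.Parity.GeneralizedHardyLittlewood.Theorems.MomentsBeyondDiagonal.TwoOrderAFE
  (exp_one_le_qhat norm_one_add_neg_one_pow_le)

/-! ## §1. One layer from its order-`(i, j)` divisor-first sums -/

/-- **A Petersson layer from its order-`(i,j)` divisor-first sums**: for `q ≥ 324` (so `log q̂ ≥ 1`), if
`‖I_{ij}(r)‖ ≤ G i j` for all `i, j ≤ deg Q`, then `‖K_r‖ ≤ 2 q̂ Σ_{i,j ≤ deg Q} |Qᵢ||Qⱼ| G i j`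
(`|ℓ^{−(i+j)}| ≤ 1`, `|1 + (−1)^{i+j}| ≤ 2`). [cite: KowalskiMichelVanderKam2000, §5 p. 13] -/
theorem norm_layer_le_of_order_le (q : ℕ) [NeZero q] (hq : 324 ≤ q) (P Q : ℝ[X]) (Δ' : ℝ) (r : ℕ) {G : ℕ → ℕ → ℝ}
    (hG : ∀ i ∈ range (Q.natDegree + 1), ∀ j ∈ range (Q.natDegree + 1),
      ‖∑ d₁ ∈ Icc 1 ⌊KMV2000.qhat q ^ Δ'⌋₊, ∑ d₂ ∈ Icc 1 ⌊KMV2000.qhat q ^ Δ'⌋₊,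
        ∑ m₁ ∈ Icc 1 (⌊KMV2000.qhat q ^ Δ'⌋₊ / d₁), ∑ n₁ ∈ Icc 1 (q ^ 2 / d₁),
        ∑ m₂ ∈ Icc 1 (⌊KMV2000.qhat q ^ Δ'⌋₊ / d₂), ∑ n₂ ∈ Icc 1 (q ^ 2 / d₂),
          ((((((d₁ * n₁ : ℕ) : ℝ) * ((d₂ * n₂ : ℕ) : ℝ)) ^ (-(1 / 2 : ℝ)) : ℝ) : ℂ) *
              afeW (KMV2000.qhat q) i j (d₁ * n₁) (d₂ * n₂)) *
            ((KMV2000.mollifierCoeff P (KMV2000.qhat q ^ Δ') (d₁ * m₁) : ℂ) *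
              (KMV2000.mollifierCoeff P (KMV2000.qhat q ^ Δ') (d₂ * m₂) : ℂ) *
              layerKernel q r (m₁ * n₁) (m₂ * n₂))‖ ≤ G i j) :
    ‖layer q P Q Δ' r‖ ≤
      2 * KMV2000.qhat q * ∑ i ∈ range (Q.natDegree + 1), ∑ j ∈ range (Q.natDegree + 1),
        |Q.coeff i| * |Q.coeff j| * G i j := by
  have h64 : 64 ≤ q := le_trans (by norm_num) hq
  have hqh1 : 1 < KMV2000.qhat q := one_lt_qhat h64
  have hqh0 : 0 < KMV2000.qhat q := zero_lt_one.trans hqh1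
  have hqe : Real.exp 1 ≤ KMV2000.qhat q := exp_one_le_qhat hq
  have hlog1 : 1 ≤ Real.log (KMV2000.qhat q) := by rwa [Real.le_log_iff_exp_le hqh0]
  have hlog0 : 0 < Real.log (KMV2000.qhat q) := by linarith
  have hℓ : 0 ≤ (Real.log (KMV2000.qhat q))⁻¹ := inv_nonneg.mpr hlog0.le
  have hℓ1 : (Real.log (KMV2000.qhat q))⁻¹ ≤ 1 := inv_le_one_of_one_le₀ hlog1
  have hq2 : ‖(KMV2000.qhat q : ℂ)‖ = KMV2000.qhat q := by
    rw [Complex.norm_real, Real.norm_eq_abs, abs_of_pos hqh0]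
  rw [layer_eq_sum_divisors_first]
  have hterm : ∀ i ∈ range (Q.natDegree + 1), ∀ j ∈ range (Q.natDegree + 1), ∀ (S : ℂ), ‖S‖ ≤ G i j →
      ‖(Q.coeff i : ℂ) * (Q.coeff j : ℂ) * (((Real.log (KMV2000.qhat q))⁻¹ : ℝ) : ℂ) ^ (i + j) *
          (1 + (-1 : ℂ) ^ (i + j)) * (KMV2000.qhat q : ℂ) * S‖ ≤
        2 * KMV2000.qhat q * (|Q.coeff i| * |Q.coeff j| * G i j) := by
    intro i _ j _ S hS
    have hG0 : 0 ≤ G i j := (norm_nonneg _).trans hS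
    rw [norm_mul, norm_mul, norm_mul, norm_mul, norm_mul, norm_pow, Complex.norm_real, Complex.norm_real,
      Complex.norm_real, Real.norm_eq_abs, Real.norm_eq_abs, Real.norm_eq_abs, abs_of_nonneg hℓ, hq2]
    have hpow : (Real.log (KMV2000.qhat q))⁻¹ ^ (i + j) ≤ 1 := pow_le_one₀ hℓ hℓ1
    have hsgn := norm_one_add_neg_one_pow_le (i + j)
    calc |Q.coeff i| * |Q.coeff j| * (Real.log (KMV2000.qhat q))⁻¹ ^ (i + j) * ‖(1 + (-1 : ℂ) ^ (i + j))‖ *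
          KMV2000.qhat q * ‖S‖
        ≤ |Q.coeff i| * |Q.coeff j| * 1 * 2 * KMV2000.qhat q * G i j := by gcongr
      _ = 2 * KMV2000.qhat q * (|Q.coeff i| * |Q.coeff j| * G i j) := by ring
  calc _ ≤ ∑ i ∈ range (Q.natDegree + 1), ∑ j ∈ range (Q.natDegree + 1),
          2 * KMV2000.qhat q * (|Q.coeff i| * |Q.coeff j| * G i j) := by
        refine (norm_sum_le _ _).trans (Finset.sum_le_sum fun i hi ↦ ?_)
        exact (norm_sum_le _ _).trans (Finset.sum_le_sum fun j hj ↦ hterm i hi j hj _ (hG i hi j hj))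
    _ = _ := by rw [mul_sum]; refine sum_congr rfl fun i _ ↦ ?_; rw [mul_sum]

/-! ## §2. The print band and `stub_farP`'s signature from per-order bounds -/

/-- **The PRINT BAND from PER-ORDER POWER SAVINGS.** If on some window `(1, Δ₀]` (`Δ₀ > 1`), for every admissible `P` and
every `Δ'` in the window there is ONE `δ > 0` such that for every order `(i, j)` there are `A, q₀` with
`‖I_{ij}(r)‖ ≤ A · q̂^{−δ} / r` for all primes `q ≥ q₀` (with `q̂^{Δ'} ∉ ℕ`) and all `⌊q̂^{ρ_P}⌋ < r ≤ ⌊q̂^{ρ_W}⌋`, then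
`SubBand rhoP rhoWeil`. [folklore] -/
theorem subBand_rhoP_rhoWeil_of_order_bound {Δ₀ : ℝ} (hΔ₀ : 1 < Δ₀)
    (h : ∀ P : ℝ[X], KMV2000.Admissible P → ∀ Δ' : ℝ, 1 < Δ' → Δ' ≤ Δ₀ →
      ∃ δ : ℝ, 0 < δ ∧ ∀ i j : ℕ, ∃ A : ℝ, ∃ q₀ : ℕ, ∀ (q : ℕ) [NeZero q], q.Prime → q₀ ≤ q →
        (∀ n : ℕ, (n : ℝ) ≠ KMV2000.qhat q ^ Δ') →
        ∀ r ∈ Icc (layerCount q rhoP Δ' + 1) (layerCount q rhoWeil Δ'),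
          ‖∑ d₁ ∈ Icc 1 ⌊KMV2000.qhat q ^ Δ'⌋₊, ∑ d₂ ∈ Icc 1 ⌊KMV2000.qhat q ^ Δ'⌋₊,
            ∑ m₁ ∈ Icc 1 (⌊KMV2000.qhat q ^ Δ'⌋₊ / d₁), ∑ n₁ ∈ Icc 1 (q ^ 2 / d₁),
            ∑ m₂ ∈ Icc 1 (⌊KMV2000.qhat q ^ Δ'⌋₊ / d₂), ∑ n₂ ∈ Icc 1 (q ^ 2 / d₂),
              ((((((d₁ * n₁ : ℕ) : ℝ) * ((d₂ * n₂ : ℕ) : ℝ)) ^ (-(1 / 2 : ℝ)) : ℝ) : ℂ) *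
                  afeW (KMV2000.qhat q) i j (d₁ * n₁) (d₂ * n₂)) *
                ((KMV2000.mollifierCoeff P (KMV2000.qhat q ^ Δ') (d₁ * m₁) : ℂ) *
                  (KMV2000.mollifierCoeff P (KMV2000.qhat q ^ Δ') (d₂ * m₂) : ℂ) *
                  layerKernel q r (m₁ * n₁) (m₂ * n₂))‖ ≤
            A * KMV2000.qhat q ^ (-δ) * ((r : ℝ))⁻¹) :
    SubBand rhoP rhoWeil := by
  refine subBand_rhoP_rhoWeil_of_layer_bound hΔ₀ fun P Q hP _ Δ' h1 h2 ↦ ?_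
  obtain ⟨δ, hδ, hij⟩ := h P hP Δ' h1 h2
  choose A q₀ hA using hij
  set d : ℕ := Q.natDegree with hd
  set S : Finset (ℕ × ℕ) := range (d + 1) ×ˢ range (d + 1) with hS
  set C : ℝ := 2 * ∑ i ∈ range (d + 1), ∑ j ∈ range (d + 1), |Q.coeff i| * |Q.coeff j| * max (A i j) 0 with hC
  refine ⟨C, δ, hδ, max (S.sup fun p ↦ q₀ p.1 p.2) 324, fun q _ hq hq₀ hM r hr ↦ ?_⟩
  have h324 : 324 ≤ q := le_trans (le_max_right _ _) hq₀
  have h64 : 64 ≤ q := le_trans (by norm_num) h324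
  have hqh0 : 0 < KMV2000.qhat q := zero_lt_one.trans (one_lt_qhat h64)
  have hr0 : 0 ≤ ((r : ℝ))⁻¹ := by positivity
  have hq₀ij : ∀ i ∈ range (d + 1), ∀ j ∈ range (d + 1), q₀ i j ≤ q := by
    intro i hi j hj
    have hmem : (i, j) ∈ S := by rw [hS]; exact mem_product.mpr ⟨hi, hj⟩
    exact le_trans (le_trans (Finset.le_sup (f := fun p : ℕ × ℕ ↦ q₀ p.1 p.2) hmem) (le_max_left _ _)) hq₀
  have hlayer := norm_layer_le_of_order_le q h324 P Q Δ' r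
    (G := fun i j ↦ max (A i j) 0 * KMV2000.qhat q ^ (-δ) * ((r : ℝ))⁻¹) fun i hi j hj ↦
      (hA i j q hq (hq₀ij i hi j hj) hM r hr).trans
        (mul_le_mul_of_nonneg_right (mul_le_mul_of_nonneg_right (le_max_left _ _) (Real.rpow_nonneg hqh0.le _)) hr0)
  have hsplit : KMV2000.qhat q ^ (1 - δ) = KMV2000.qhat q * KMV2000.qhat q ^ (-δ) := by
    rw [sub_eq_add_neg, Real.rpow_add hqh0, Real.rpow_one]
  refine hlayer.trans (le_of_eq ?_)
  rw [hC, hsplit]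
  simp only [mul_sum, sum_mul]
  refine sum_congr rfl fun i _ ↦ sum_congr rfl fun j _ ↦ ?_
  ring

/-- **`stub_farP`'s signature `SubFar rhoP` from PER-ORDER POWER SAVINGS in the print band** (famedge-1's
`FarLayers.subFar_rhoP_of_band` ∘ `subBand_rhoP_rhoWeil_of_order_bound`): what remains of `stub_farP` is, for each admissible
`P`, each `Δ'` in a short window and each order `(i, j)`, the bound `‖I_{ij}(r)‖ ≤ A q̂^{−δ}/r` on `q̂^{ρ_P} < r ≤ q̂^{ρ_W}` with
ONE `δ = δ(P, Δ') > 0`. [folklore] -/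
theorem subFar_rhoP_of_order_bound {Δ₀ : ℝ} (hΔ₀ : 1 < Δ₀)
    (h : ∀ P : ℝ[X], KMV2000.Admissible P → ∀ Δ' : ℝ, 1 < Δ' → Δ' ≤ Δ₀ →
      ∃ δ : ℝ, 0 < δ ∧ ∀ i j : ℕ, ∃ A : ℝ, ∃ q₀ : ℕ, ∀ (q : ℕ) [NeZero q], q.Prime → q₀ ≤ q →
        (∀ n : ℕ, (n : ℝ) ≠ KMV2000.qhat q ^ Δ') →
        ∀ r ∈ Icc (layerCount q rhoP Δ' + 1) (layerCount q rhoWeil Δ'),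
          ‖∑ d₁ ∈ Icc 1 ⌊KMV2000.qhat q ^ Δ'⌋₊, ∑ d₂ ∈ Icc 1 ⌊KMV2000.qhat q ^ Δ'⌋₊,
            ∑ m₁ ∈ Icc 1 (⌊KMV2000.qhat q ^ Δ'⌋₊ / d₁), ∑ n₁ ∈ Icc 1 (q ^ 2 / d₁),
            ∑ m₂ ∈ Icc 1 (⌊KMV2000.qhat q ^ Δ'⌋₊ / d₂), ∑ n₂ ∈ Icc 1 (q ^ 2 / d₂),
              ((((((d₁ * n₁ : ℕ) : ℝ) * ((d₂ * n₂ : ℕ) : ℝ)) ^ (-(1 / 2 : ℝ)) : ℝ) : ℂ) *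
                  afeW (KMV2000.qhat q) i j (d₁ * n₁) (d₂ * n₂)) *
                ((KMV2000.mollifierCoeff P (KMV2000.qhat q ^ Δ') (d₁ * m₁) : ℂ) *
                  (KMV2000.mollifierCoeff P (KMV2000.qhat q ^ Δ') (d₂ * m₂) : ℂ) *
                  layerKernel q r (m₁ * n₁) (m₂ * n₂))‖ ≤
            A * KMV2000.qhat q ^ (-δ) * ((r : ℝ))⁻¹) :
    SubFar rhoP :=
  subFar_rhoP_of_band (subBand_rhoP_rhoWeil_of_order_bound hΔ₀ h)

end Summit.Parity.GeneralizedHardyLittlewood.Theorems.MomentsBeyondDiagonal.Layers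

end
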